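import Literature.MathematicalPhysics.QuantumFieldTheory.Balaban1983to89.T4ForestGaugeSameRootBound
import Literature.MathematicalPhysics.QuantumFieldTheory.Balaban1983to89.B15Prop1DatumGaugeNormalisation

/-!
# `Balaban1983to89.T4WordSystemGaugeBound` — THE WORD-SYSTEM NORMALISER: a gauge transformation of `T^{(j)}`, EQUAL TO `1` ON A
# PRESCRIBED SET, after which a configuration with small plaquettes along a ROOTED WORD SYSTEM is bond-wise near `1` on the region the
# words reach; and, at the objects of [Balaban1989LargeFieldI] Prop. 1, the normaliser of the extended datum `Ṽ_k` on such a region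

Cell `pub-ymgap` (Track A DAG, node N12 = [B15] = T. Bałaban, *Large field renormalization. I*, Commun. Math. Phys. **122** (1989) 175–202
[Balaban1989LargeFieldI]), width seat `dag-n12-w2` (g4), piece (P1) handed out by the lane owner dag-n12-c g18 (cell bus l.36670): the PRODUCER of
the displayed letter `hgauge` of `B15Prop1CoerciveAtNormalisedDatum.sliceCoercive_of_gaugeNormalisable` ∕ `hcoer_of_nearFlatLettersGaugeNormalisable_sub_loc`
(v1.1 §5, «LOCATED-GEOM made a hypothesis») BEYOND PARALLELEPIPEDS.  Count-neutral Literature helper; HONEST FRAMING: lattice gauge bookkeeping on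
the tree's own objects (parallel transport along words, the located non-abelian Stokes bound of `LatticeWordStokesLocal`, print's p. 193 extension);
nothing of [15] Thm 1 ∕ Proposition 1 is asserted; N12 is not discharged by this file; one finite `𝕋⁴` programme at fixed `ε`; nothing here bears on
the continuum ∕ OS ∕ mass-gap statement.

THE POINT (p. 194, the sentence after (1.77): *«The function is invariant with respect to the group of all gauge transformations defined on Λ,
hence it is natural to consider it on orbits of this group.»*).  dag-n12-w6's `B15Prop1DatumGaugeNormalisation.exists_gauge_normalising_extend_shellGauged`
normalises the extended datum on a region PARALLELEPIPED `[LO, HI]` by the corner axial gauge of that box.  Print's regions `Z` are unions of big cubes,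
not boxes.  Here the box is replaced by a ROOTED WORD SYSTEM: a root `r`, and for every site `x` of a set `X` a lattice word `w x` of length `≤ ℓ` with
`walkEnd r (w x) = x`.  The HOLONOMY GAUGE `a(x) = 𝒰_W(walk r (w x))` ([Balaban1985Averaging] (8)–(9): parallel transport; [Balaban1985RegularSpaces]
(1.19): axial gauges of trees) turns the bond variable at `b = ⟨s, s + e_μ⟩` into the holonomy of the CLOSED word `w s · (+e_μ) · (w (s+e_μ))ᵒᵖ` at `r`
(dag-n12-w6's `T4ForestGaugeSameRootBound.dist1_holAt_bond_le_of_sameRoot_of_length_lt`), which the located Stokes bound of ym3-torus-p2's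
`LatticeWordStokesLocal.dist1_holAt_le_local` controls by the plaquettes based in the COUNT BOX of that word: `dist1 ≤ ((2ℓ+1)²∕4)·δ`.  Gluing `a` to `1`
on a prescribed site set `B ⊆ X` whose words stay inside `B` and on which `W` is already `ε₁`-near `1` costs `(ℓ+1)·ε₁` (§2).  At the objects of
Proposition 1 (§3) — `W = (cutoff Λ^{(k)} g) • Ṽ_k` (dag-n12-w6 §7: `1` on every bond meeting `Λ^{(k)}`, `3d(n+2)²ε`-near `1` on the whole big box
`[lo − 1, hi + 1]`, plaquettes `(12d(n+2)² + 1)ε`-small on `Z^{(k)}`), `B` = the big box — this yields the normaliser in EXACTLY the shape of the lane's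
letter `hgauge`: `∃ u, (∀ s ∈ Λ^{(k)}, u s = 1) ∧ u(c₀) = 1 ∧ ∀ b ∈ 𝒞, dist1 ((Ṽ_k)^u b) ≤ ρ`, for every bond set `𝒞` whose bonds have both ends in `X`,
under ONE geometric letter: the count boxes of the loop words lie in `Z^{(k)}` (`hcount`).

WHAT IS PROVED (no `def`, no `sorry`; `G` any `GaugeGroup`; standing hypotheses as in dag-n12-w6's §7 for §3):
* §1 `dist1_holAt_le_length_mul` (a transport through `ε₁`-near-`1` bonds is `|γ|·ε₁`-near `1`), `length_walk'`, ★ `dist1_holAt_bond_le_of_words`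
  (the one-bond bound at a word system, lengths `≤ ℓ`: `((2ℓ+1)²∕4)·δ`);
* §2 ★★ `exists_gauge_one_on_nearFlat_of_words` — the glued normaliser: `u = 1` on `B`, `u = a` off `B`, `dist1 (W^u b) ≤ ((2ℓ+1)²∕4)·δ + (ℓ+1)·ε₁` on every
  bond with both ends in `X`;
* §3 ★★★ `exists_gauge_normalising_extend_of_words` (explicit constant) and ★★★ `exists_gauge_normalising_extend_of_words_le` (any `ρ` above it, any `𝒞`
  with ends in `X` — the letter `hgauge` VERBATIM).
WHAT THIS IS NOT: no word system is constructed here (the caller's geometry: e.g. the BFS ∕ geodesic forests of `Summits/…/BalabanUVNodesN12RootedForest*`,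
or stair words inside a simply-connected union of cubes); the count-box letter `hcount` is displayed, not discharged; constants crude.

References: T. Bałaban, CMP 122 (1989) 175–202 [Balaban1989LargeFieldI] (p.193, p.194); CMP 98 (1985) 17–51 [Balaban1985Averaging] ((8)–(9) p.19,
(19)–(20) p.21); CMP 102 (1985) 277–309 [Balaban1985Variational] ((16)–(18) p.280); J. Math. Phys. 26 (1985) [Balaban1985RegularSpaces] ((1.19) p.79).
-/

noncomputable section

open Set

namespace Literature.MathematicalPhysics.QuantumFieldTheory.Balaban1983to89.T4WordSystemGaugeBound

open T4Continuum T4ReflectionCone B15DeterminingSets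
open B15Prop1Carrier (plaqsInside)
open T4ForestGaugeSameRootBound (dist1_holAt_bond_le_of_sameRoot_of_length_lt)
open T4AxialGaugeSmallField (castSite castSite_add_e boxPlaqs boxBonds)
open B7Prop1Explicit (e e_apply)
open B15Extension193 (extend cutoff cutoff_of_mem cutoff_of_not_mem)
open B15ShellGauge193 (shellGauge)
open B15ShellGauge193Local (dist1_plaqHol_extend_shellGauge_le)
open B15Prop1DatumGaugeNormalisation (dist1_primed_shellGauge_le_bigBox gaugeAct_mul_eq shellGauge_corner_eq_one)
open T4ReTrLipUnitary (plaqSmallOn_gaugeAct_iff)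

/-! ## §1 Transports through near-flat bonds; the one-bond bound at a word system -/

section Words

variable {P : Params} {j : ℕ} {G : Type*} [GaugeGroup G]

/-- A parallel transport through bonds that are `ε₁`-near `1` is `|γ|·ε₁`-near `1` ((19)–(20): `|XY − 1| ≤ |X − 1| + |Y − 1|`, `|X⁻¹ − 1| = |X − 1|`;
the Summits-side `…Theorems.K0UniformFluxConfig.dist1_holAt_le_length_mul` is a cousin, not importable here). [cite: Balaban1985Averaging, (8)-(9) p.19 and (19)-(20) p.21] -/
theorem dist1_holAt_le_length_mul (W : GaugeField P j G) {ε₁ : ℝ} (hε₁ : 0 ≤ ε₁) :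
    ∀ γ : List (LStep P j), (∀ s ∈ γ, dist1 (W s.bond) ≤ ε₁) → dist1 (holAt W γ) ≤ γ.length * ε₁
  | [], _ => by simp [holAt_nil, GaugeGroup.dist1_one]
  | s :: γ, h => by
    rw [holAt_cons, List.length_cons]
    have hs : dist1 (if s.fwd then W s.bond else (W s.bond)⁻¹) ≤ ε₁ := by
      split_ifs
      · exact h s (by simp)
      · rw [GaugeGroup.dist1_inv]; exact h s (by simp)
    have ih := dist1_holAt_le_length_mul W hε₁ γ fun t ht => h t (List.mem_cons_of_mem _ ht)
    calc dist1 ((if s.fwd then W s.bond else (W s.bond)⁻¹) * holAt W γ)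
        ≤ dist1 (if s.fwd then W s.bond else (W s.bond)⁻¹) + dist1 (holAt W γ) := GaugeGroup.dist1_mul_le _ _
      _ ≤ ε₁ + γ.length * ε₁ := add_le_add hs ih
      _ = ((γ.length + 1 : ℕ) : ℝ) * ε₁ := by push_cast; ring

/-- A walk has as many steps as its word has letters (the tree's `T4AvgDerivBound.length_walk` ∕ `BlockAveragingEMLLinearised.length_walk`, neither in this
file's import cone). [cite: Balaban1985Averaging, (8)-(9) p.19] -/
theorem length_walk' : ∀ (x : Site P j) (w : List (Letter P.d)), (walk x w).length = w.length
  | _, [] => rfl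
  | x, (μ, true) :: w => by simp only [walk, List.length_cons, length_walk' (x.shift μ) w]
  | x, (μ, false) :: w => by simp only [walk, List.length_cons, length_walk' (x.unshift μ) w]

/-- ★ **THE ONE-BOND BOUND AT A ROOTED WORD SYSTEM**: root `r`, words `w s`, `w (s + e_μ)` of lengths `≤ ℓ` ending at `s`, `s + e_μ` (`2ℓ + 1 < #sites per direction`:
no wrapping); if every plaquette based in the COUNT BOX of the loop word `w s · (+e_μ) · (w (s+e_μ))ᵒᵖ` is within `δ ≥ 0` of `1`, then
`dist1 (a(s)·W(s, s+e_μ)·a(s+e_μ)⁻¹) ≤ ((2ℓ+1)²∕4)·δ` for the holonomy gauge `a(x) = 𝒰_W(walk r (w x))` (dag-n12-w6's same-root bound with the lengths majorised).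
[cite: Balaban1985Variational, (16)-(18) p.280; Balaban1985Averaging, (19)-(20) p.21] -/
theorem dist1_holAt_bond_le_of_words (W : GaugeField P j G) (r s : Site P j) (μ : Fin P.d) (w : Site P j → List (Letter P.d))
    (hs : walkEnd r (w s) = s) (ht : walkEnd r (w (s.shift μ)) = s.shift μ) {ℓ : ℕ} (hℓs : (w s).length ≤ ℓ)
    (hℓt : (w (s.shift μ)).length ≤ ℓ) (hℓN : 2 * ℓ + 1 < P.sitesPerDir j) {δ : ℝ} (hδ : 0 ≤ δ)
    (hloc : ∀ u : List (Letter P.d), (∀ l, u.count l ≤ (w s ++ (μ, true) :: wordRev (w (s.shift μ))).count l) →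
      ∀ (a b : Fin P.d) (hab : a < b), dist1 (GaugeField.plaqHol W ⟨walkEnd r u, a, b, hab⟩) < δ) :
    dist1 (holAt W (walk r (w s)) * W ⟨s, μ⟩ * (holAt W (walk r (w (s.shift μ))))⁻¹) ≤ (((2 * ℓ + 1 : ℕ) : ℝ) ^ 2 / 4) * δ := by
  have hlen : (w s).length + 1 + (w (s.shift μ)).length < P.sitesPerDir j := by omega
  refine (dist1_holAt_bond_le_of_sameRoot_of_length_lt W r s μ (w s) (w (s.shift μ)) hs ht hlen hδ hloc).trans ?_
  have hm : (((w s).length + 1 + (w (s.shift μ)).length : ℕ) : ℝ) ≤ ((2 * ℓ + 1 : ℕ) : ℝ) := by exact_mod_cast (by omega)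
  have h0 : (0 : ℝ) ≤ (((w s).length + 1 + (w (s.shift μ)).length : ℕ) : ℝ) := Nat.cast_nonneg _
  exact mul_le_mul_of_nonneg_right (div_le_div_of_nonneg_right (pow_le_pow_left₀ h0 hm 2) (by norm_num)) hδ

end Words

/-! ## §2 ★★ The glued normaliser: `1` on `B`, the holonomy gauge off `B` -/

section Glue

variable {P : Params} {j : ℕ} {G : Type*} [GaugeGroup G]

/-- ★★ **THE WORD-SYSTEM NORMALISER** (any `GaugeGroup`, level `j`).  Data: a configuration `W`; site sets `B ⊆ X`; a root `r` and words `w x` (`x ∈ X`)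
with `walkEnd r (w x) = x`, `|w x| ≤ ℓ`, `2ℓ + 1 < #sites per direction`; the words of the sites of `B` run through bonds with BOTH ends in `B` (`hin`);
`W` is `ε₁`-near `1` on the bonds with both ends in `B` (`h1`); and for every bond `⟨s, s+e_μ⟩` with both ends in `X`, not both in `B`, every plaquette based
in the count box of the loop word `w s · (+e_μ) · (w (s+e_μ))ᵒᵖ` is within `δ` of `1` (`hloc`).  Conclusion: there is a gauge transformation `u` with
`u = 1` ON `B`, `u(x) = 𝒰_W(walk r (w x))` off `B`, and `dist1 (W^u b) ≤ ((2ℓ+1)²∕4)·δ + (ℓ+1)·ε₁` on every bond with both ends in `X`.  (The four cases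
`b₋, b₊ ∈ B` or not; the mixed ones insert `a(x)`, `x ∈ B`, which is `ℓ·ε₁`-near `1` by `hin` + `h1`.) [cite: Balaban1989LargeFieldI, p.194 (sentence after (1.77)); Balaban1985Averaging, (8)-(9) p.19] -/
theorem exists_gauge_one_on_nearFlat_of_words (W : GaugeField P j G) (B X : Set (Site P j)) (hBX : B ⊆ X)
    (r : Site P j) (w : Site P j → List (Letter P.d)) (hX : ∀ x ∈ X, walkEnd r (w x) = x)
    {ℓ : ℕ} (hℓ : ∀ x ∈ X, (w x).length ≤ ℓ) (hℓN : 2 * ℓ + 1 < P.sitesPerDir j)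
    (hin : ∀ x ∈ B, ∀ st ∈ walk r (w x), st.bond.src ∈ B ∧ st.bond.tgt ∈ B)
    {ε₁ δ : ℝ} (hε₁ : 0 ≤ ε₁) (hδ : 0 ≤ δ)
    (h1 : ∀ b : PBond P j, b.src ∈ B → b.tgt ∈ B → dist1 (W b) ≤ ε₁)
    (hloc : ∀ (s : Site P j) (μ : Fin P.d), s ∈ X → s.shift μ ∈ X → ¬ (s ∈ B ∧ s.shift μ ∈ B) →
      ∀ u : List (Letter P.d), (∀ l, u.count l ≤ (w s ++ (μ, true) :: wordRev (w (s.shift μ))).count l) →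
      ∀ (a b : Fin P.d) (hab : a < b), dist1 (GaugeField.plaqHol W ⟨walkEnd r u, a, b, hab⟩) < δ) :
    ∃ u : GaugeTransf P j G, (∀ s ∈ B, u s = 1) ∧ (∀ s, s ∉ B → u s = holAt W (walk r (w s))) ∧
      ∀ b : PBond P j, b.src ∈ X → b.tgt ∈ X →
        dist1 (GaugeField.gaugeAct u W b) ≤ (((2 * ℓ + 1 : ℕ) : ℝ) ^ 2 / 4) * δ + (ℓ + 1) * ε₁ := by
  classical
  set a : GaugeTransf P j G := fun x => holAt W (walk r (w x)) with ha
  set C : ℝ := (((2 * ℓ + 1 : ℕ) : ℝ) ^ 2 / 4) * δ with hC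
  have hC0 : 0 ≤ C := by positivity
  -- `a` is `ℓ ε₁`-near `1` on `B`
  have haB : ∀ x ∈ B, dist1 (a x) ≤ ℓ * ε₁ := fun x hx => by
    have h := dist1_holAt_le_length_mul W hε₁ (walk r (w x)) fun st hst => h1 st.bond (hin x hx st hst).1 (hin x hx st hst).2
    rw [length_walk'] at h
    exact h.trans (mul_le_mul_of_nonneg_right (by exact_mod_cast hℓ x (hBX hx)) hε₁)
  -- the pure holonomy-gauge bound on the bonds not inside `B`
  have hab : ∀ (s : Site P j) (μ : Fin P.d), s ∈ X → s.shift μ ∈ X → ¬ (s ∈ B ∧ s.shift μ ∈ B) →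
      dist1 (a s * W ⟨s, μ⟩ * (a (s.shift μ))⁻¹) ≤ C := fun s μ hs ht hnb =>
    dist1_holAt_bond_le_of_words W r s μ w (hX s hs) (hX _ ht) (hℓ s hs) (hℓ _ ht) hℓN hδ (hloc s μ hs ht hnb)
  refine ⟨fun s => if s ∈ B then 1 else a s, fun s hs => if_pos hs, fun s hs => if_neg hs, ?_⟩
  rintro ⟨s, μ⟩ hs ht
  simp only at hs ht
  change s.shift μ ∈ X at ht
  show dist1 ((if s ∈ B then 1 else a s) * W ⟨s, μ⟩ * (if s.shift μ ∈ B then 1 else a (s.shift μ))⁻¹) ≤ C + (ℓ + 1) * ε₁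
  have hℓε : (0 : ℝ) ≤ ℓ * ε₁ := by positivity
  by_cases hsB : s ∈ B <;> by_cases htB : s.shift μ ∈ B
  · rw [if_pos hsB, if_pos htB, one_mul, inv_one, mul_one]
    have h := h1 ⟨s, μ⟩ hsB htB
    nlinarith
  · rw [if_pos hsB, if_neg htB]
    have e1 : (1 : G) * W ⟨s, μ⟩ * (a (s.shift μ))⁻¹ = (a s)⁻¹ * (a s * W ⟨s, μ⟩ * (a (s.shift μ))⁻¹) := by group
    rw [e1]
    calc dist1 ((a s)⁻¹ * (a s * W ⟨s, μ⟩ * (a (s.shift μ))⁻¹))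
        ≤ dist1 (a s)⁻¹ + dist1 (a s * W ⟨s, μ⟩ * (a (s.shift μ))⁻¹) := GaugeGroup.dist1_mul_le _ _
      _ ≤ ℓ * ε₁ + C := by rw [GaugeGroup.dist1_inv]; exact add_le_add (haB s hsB) (hab s μ hs ht (fun h => htB h.2))
      _ ≤ C + (ℓ + 1) * ε₁ := by nlinarith
  · rw [if_neg hsB, if_pos htB, inv_one]
    have e1 : a s * W ⟨s, μ⟩ * 1 = (a s * W ⟨s, μ⟩ * (a (s.shift μ))⁻¹) * a (s.shift μ) := by group
    rw [e1]
    calc dist1 ((a s * W ⟨s, μ⟩ * (a (s.shift μ))⁻¹) * a (s.shift μ))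
        ≤ dist1 (a s * W ⟨s, μ⟩ * (a (s.shift μ))⁻¹) + dist1 (a (s.shift μ)) := GaugeGroup.dist1_mul_le _ _
      _ ≤ C + ℓ * ε₁ := add_le_add (hab s μ hs ht (fun h => hsB h.1)) (haB _ htB)
      _ ≤ C + (ℓ + 1) * ε₁ := by nlinarith
  · rw [if_neg hsB, if_neg htB]
    have h := hab s μ hs ht (fun h => hsB h.1)
    nlinarith

end Glue

/-! ## §3 ★★★ At the objects of Proposition 1: the normaliser of the extended datum on a word-system region -/

section Prop1

variable {P : Params} {k : ℕ} {G : Type*} [GaugeGroup G] {lo hi : Fin P.d → ℤ}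

/-- The big box contains `Λ^{(k)} = castSite '' [lo, hi]`. [cite: Balaban1989LargeFieldI, p.193] -/
private theorem mem_bigBox_of_mem_box {x : Fin P.d → ℤ} (hx : lo ≤ x) (hx' : x ≤ hi) :
    (castSite x : Site P k) ∈ (castSite '' Set.Icc (lo - 1) (hi + 1) : Set (Site P k)) :=
  ⟨x, ⟨fun κ => by have := hx κ; rw [Pi.sub_apply, Pi.one_apply]; linarith,
    fun κ => by have := hx' κ; rw [Pi.add_apply, Pi.one_apply]; linarith⟩, rfl⟩

/-- ★★★ **THE WORD-SYSTEM NORMALISER OF THE EXTENDED DATUM** (any `GaugeGroup`, `d ≥ 3`; the objects of Proposition 1 as in dag-n12-w6's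
`exists_gauge_normalising_extend_shellGauged`: `Λ^{(k)} = castSite '' [lo, hi]` of at most `n + 1` sites per direction, non-wrapping, the big box's
plaquettes in `Z^{(k)}`, the (1.74) guard `PlaqSmallOn (plaqsInside (Z ∩ Λᶜ)^{(k)}) ε V_k`).  REGION DATA instead of a parallelepiped: a root `r`, a site set
`X ⊇ castSite '' [lo − 1, hi + 1]` (the big box) and words `w x`, `x ∈ X`, with `walkEnd r (w x) = x`, `|w x| ≤ ℓ`, `2ℓ + 1 < #sites per direction`, the words of the
big-box sites running through bonds with both ends in the big box (`hin`), and ONE geometric letter `hcount`: for every bond `⟨s, s + e_μ⟩` with both ends in `X`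
and not both in the big box, every plaquette based in the count box of the loop word `w s · (+e_μ) · (w (s+e_μ))ᵒᵖ` lies in `Z^{(k)}`.  CONCLUSION: a gauge
transformation `u` of `T^{(k)}` with `u = 1` on `Λ^{(k)}`, `u(c₀) = 1` at the shell corner `c₀ = castSite (lo − 1)`, and
`dist1 ((Ṽ_k)^u b) ≤ ((2ℓ+1)²∕4)·(12d(n+2)² + 1)ε + (ℓ+1)·3d(n+2)²ε` on every bond with both ends in `X` (`Ṽ_k = extend Λ^{(k)} (shellGauge V_k lo hi) V_k`).
Proof: `u = u_words · cutoff Λ^{(k)} g` with `u_words` = §2 for `W = (cutoff g) • Ṽ_k` (dag-n12-w6 §7: near `1` on the big box, small plaquettes on `Z^{(k)}`) and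
`B` = the big box. [cite: Balaban1989LargeFieldI, p.193, p.194 (sentence after (1.77))] -/
theorem exists_gauge_normalising_extend_of_words (hd : 3 ≤ P.d) (hlohi : lo ≤ hi) {n : ℕ}
    (hn : ∀ κ, hi κ ≤ lo κ + n) (hN : ∀ κ, hi κ - lo κ + 3 < (P.sitesPerDir k : ℤ)) {Z Λ : Set (Site P 0)}
    (hbox : pts k Λ = (castSite '' Set.Icc lo hi : Set (Site P k)))
    (hZ : (boxPlaqs (lo - 1) (hi + 1) : Set (Plaq P k)) ⊆ plaqsInside (pts k Z))
    {ε : ℝ} (hε : 0 < ε) {V : GaugeField P k G} (hreg : PlaqSmallOn (plaqsInside (pts k (Z ∩ Λᶜ))) ε V)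
    (X : Set (Site P k)) (hbigX : (castSite '' Set.Icc (lo - 1) (hi + 1) : Set (Site P k)) ⊆ X)
    (r : Site P k) (w : Site P k → List (Letter P.d)) (hX : ∀ x ∈ X, walkEnd r (w x) = x)
    {ℓ : ℕ} (hℓ : ∀ x ∈ X, (w x).length ≤ ℓ) (hℓN : 2 * ℓ + 1 < P.sitesPerDir k)
    (hin : ∀ x ∈ (castSite '' Set.Icc (lo - 1) (hi + 1) : Set (Site P k)), ∀ st ∈ walk r (w x),
      st.bond.src ∈ (castSite '' Set.Icc (lo - 1) (hi + 1) : Set (Site P k)) ∧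
        st.bond.tgt ∈ (castSite '' Set.Icc (lo - 1) (hi + 1) : Set (Site P k)))
    (hcount : ∀ (s : Site P k) (μ : Fin P.d), s ∈ X → s.shift μ ∈ X →
      ¬ (s ∈ (castSite '' Set.Icc (lo - 1) (hi + 1) : Set (Site P k)) ∧ s.shift μ ∈ (castSite '' Set.Icc (lo - 1) (hi + 1) : Set (Site P k))) →
      ∀ u : List (Letter P.d), (∀ l, u.count l ≤ (w s ++ (μ, true) :: wordRev (w (s.shift μ))).count l) →
      ∀ (a b : Fin P.d) (hab : a < b), (⟨walkEnd r u, a, b, hab⟩ : Plaq P k) ∈ plaqsInside (pts k Z)) :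
    ∃ u : GaugeTransf P k G, (∀ s ∈ pts k Λ, u s = 1) ∧ u (castSite (lo - 1)) = 1 ∧
      ∀ b : PBond P k, b.src ∈ X → b.tgt ∈ X →
        dist1 (GaugeField.gaugeAct u (extend (pts k Λ) (shellGauge V lo hi) V) b)
          ≤ (((2 * ℓ + 1 : ℕ) : ℝ) ^ 2 / 4) * ((12 * P.d * (n + 2) ^ 2 + 1) * ε) + (ℓ + 1) * (3 * P.d * (n + 2) ^ 2 * ε) := by
  set big : Set (Site P k) := castSite '' Set.Icc (lo - 1) (hi + 1) with hbig
  set g : GaugeTransf P k G := shellGauge V lo hi with hg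
  set W : GaugeField P k G := extend (pts k Λ) g V with hWdef
  set W' : GaugeField P k G := GaugeField.gaugeAct (cutoff (pts k Λ) g) W with hW'def
  -- plaquettes of `W′` on `Z^{(k)}` (dag-n12-w6 §4 ∕ r12's extension lemma, gauge invariance)
  obtain ⟨hplaq, -⟩ := dist1_plaqHol_extend_shellGauge_le (G := G) hd hlohi hn hN hbox hZ hε hreg
  have hW : PlaqSmallOn (plaqsInside (pts k Z)) ((12 * P.d * (n + 2) ^ 2 + 1) * ε) W := fun p hp =>
    calc dist1 (GaugeField.plaqHol W p) ≤ 12 * P.d * (n + 2) ^ 2 * ε := hplaq p hp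
      _ < (12 * P.d * (n + 2) ^ 2 + 1) * ε := by nlinarith
  have hW' : PlaqSmallOn (plaqsInside (pts k Z)) ((12 * P.d * (n + 2) ^ 2 + 1) * ε) W' :=
    (plaqSmallOn_gaugeAct_iff _ _ _ W).2 hW
  -- `W′` is near `1` on the bonds with both ends in the big box (dag-n12-w6 §7, site form by injectivity of `castSite` on the big box)
  have h1 : ∀ b : PBond P k, b.src ∈ big → b.tgt ∈ big → dist1 (W' b) ≤ 3 * P.d * (n + 2) ^ 2 * ε := by
    rintro b ⟨x, ⟨hx, hx'⟩, hsrc⟩ ⟨y, ⟨hy, hy'⟩, htgt⟩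
    refine dist1_primed_shellGauge_le_bigBox hd hlohi hn hN hbox hZ hε.le hreg b ⟨x, hx, ?_, hsrc.symm⟩
    have htgt' : (castSite y : Site P k) = castSite (x + e b.dir) := by
      rw [htgt, castSite_add_e, hsrc]; rfl
    have e1 : ∀ κ, lo κ - 1 ≤ y κ := fun κ => by have h := hy κ; rwa [Pi.sub_apply, Pi.one_apply] at h
    have e2 : ∀ κ, y κ ≤ hi κ + 2 := fun κ => by
      have h : y κ ≤ (hi + 1) κ := hy' κ
      rw [Pi.add_apply, Pi.one_apply] at h; linarith
    have e3 : ∀ κ, lo κ - 1 ≤ (x + e b.dir) κ := fun κ => by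
      have h : (lo - 1) κ ≤ x κ := hx κ
      rw [Pi.sub_apply, Pi.one_apply] at h
      have h0 : (0 : ℤ) ≤ e b.dir κ := by rw [e_apply]; split_ifs <;> simp
      rw [Pi.add_apply]; linarith
    have e4 : ∀ κ, (x + e b.dir) κ ≤ hi κ + 2 := fun κ => by
      have h : x κ ≤ (hi + 1) κ := hx' κ
      rw [Pi.add_apply, Pi.one_apply] at h
      have h0 : e b.dir κ ≤ (1 : ℤ) := by rw [e_apply]; split_ifs <;> simp
      rw [Pi.add_apply]; linarith
    have heq : y = x + e b.dir := B15Extension193.castSite_inj_big hN e1 e2 e3 e4 htgt'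
    rw [← heq]; exact hy'
  have hε' : (0 : ℝ) ≤ (12 * P.d * (n + 2) ^ 2 + 1) * ε := by positivity
  have hε₁ : (0 : ℝ) ≤ 3 * P.d * (n + 2) ^ 2 * ε := by positivity
  -- the located Stokes hypothesis on `W′` from the geometric letter
  have hloc : ∀ (s : Site P k) (μ : Fin P.d), s ∈ X → s.shift μ ∈ X → ¬ (s ∈ big ∧ s.shift μ ∈ big) →
      ∀ u : List (Letter P.d), (∀ l, u.count l ≤ (w s ++ (μ, true) :: wordRev (w (s.shift μ))).count l) →
      ∀ (a b : Fin P.d) (hab : a < b), dist1 (GaugeField.plaqHol W' ⟨walkEnd r u, a, b, hab⟩) < (12 * P.d * (n + 2) ^ 2 + 1) * ε :=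
    fun s μ hs ht hnb u hu a b hab => hW' _ (hcount s μ hs ht hnb u hu a b hab)
  obtain ⟨u', hu'1, -, hu'⟩ := exists_gauge_one_on_nearFlat_of_words W' big X hbigX r w hX hℓ hℓN hin hε₁ hε' h1 hloc
  -- the corner: in the big box, not in `Λ^{(k)}`
  have hc₀big : (castSite (lo - 1) : Site P k) ∈ big :=
    ⟨lo - 1, ⟨le_rfl, fun κ => by have := hlohi κ; rw [Pi.sub_apply, Pi.add_apply, Pi.one_apply]; linarith⟩, rfl⟩
  have hc₀Λ : (castSite (lo - 1) : Site P k) ∉ pts k Λ := by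
    rw [hbox]
    rintro ⟨x, ⟨hx, hx'⟩, hxe⟩
    have heq : x = lo - 1 := B15Extension193.castSite_inj_big hN
      (fun κ => by have := hx κ; linarith) (fun κ => by have := hx' κ; linarith)
      (fun κ => by rw [Pi.sub_apply, Pi.one_apply]) (fun κ => by have := hlohi κ; rw [Pi.sub_apply, Pi.one_apply]; linarith) hxe
    have hd0 : 0 < P.d := by omega
    have := hx ⟨0, hd0⟩
    rw [heq, Pi.sub_apply, Pi.one_apply] at this
    linarith
  refine ⟨fun s => u' s * cutoff (pts k Λ) g s, fun s hs => ?_, ?_, fun b hs ht => ?_⟩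
  · -- `u = 1` on `Λ^{(k)}` (inside the big box, where `u′ = 1`, and `cutoff g = 1`)
    have hs' : s ∈ big := by
      have hs2 := hs
      rw [hbox] at hs2; obtain ⟨x, ⟨hx, hx'⟩, rfl⟩ := hs2; exact mem_bigBox_of_mem_box hx hx'
    show u' s * cutoff (pts k Λ) g s = 1
    rw [hu'1 s hs', cutoff_of_mem g hs, one_mul]
  · -- `u(c₀) = 1` (the shell gauge is `1` at its own corner)
    show u' (castSite (lo - 1)) * cutoff (pts k Λ) g (castSite (lo - 1)) = 1
    rw [hu'1 _ hc₀big, cutoff_of_not_mem g hc₀Λ, one_mul, hg, shellGauge_corner_eq_one hlohi hN V]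
  · -- near `1` on the region
    rw [gaugeAct_mul_eq]
    exact hu' b hs ht

/-- ★★★ **THE SAME, IN THE SHAPE OF THE LANE'S LETTER `hgauge`** (`B15Prop1CoerciveAtNormalisedDatum.sliceCoercive_of_gaugeNormalisable` ∕
`hcoer_of_nearFlatLettersGaugeNormalisable_sub_loc`): for every bond set `𝒞` whose bonds have both ends in `X` and every tolerance `ρ` above the explicit constant,
`∃ u, (∀ s ∈ Λ^{(k)}, u s = 1) ∧ u (castSite (lo − 1)) = 1 ∧ ∀ b ∈ 𝒞, dist1 ((Ṽ_k)^u b) ≤ ρ`. [cite: Balaban1989LargeFieldI, p.193, p.194 (sentence after (1.77))] -/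
theorem exists_gauge_normalising_extend_of_words_le (hd : 3 ≤ P.d) (hlohi : lo ≤ hi) {n : ℕ}
    (hn : ∀ κ, hi κ ≤ lo κ + n) (hN : ∀ κ, hi κ - lo κ + 3 < (P.sitesPerDir k : ℤ)) {Z Λ : Set (Site P 0)}
    (hbox : pts k Λ = (castSite '' Set.Icc lo hi : Set (Site P k)))
    (hZ : (boxPlaqs (lo - 1) (hi + 1) : Set (Plaq P k)) ⊆ plaqsInside (pts k Z))
    {ε : ℝ} (hε : 0 < ε) {V : GaugeField P k G} (hreg : PlaqSmallOn (plaqsInside (pts k (Z ∩ Λᶜ))) ε V)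
    (X : Set (Site P k)) (hbigX : (castSite '' Set.Icc (lo - 1) (hi + 1) : Set (Site P k)) ⊆ X)
    (r : Site P k) (w : Site P k → List (Letter P.d)) (hX : ∀ x ∈ X, walkEnd r (w x) = x)
    {ℓ : ℕ} (hℓ : ∀ x ∈ X, (w x).length ≤ ℓ) (hℓN : 2 * ℓ + 1 < P.sitesPerDir k)
    (hin : ∀ x ∈ (castSite '' Set.Icc (lo - 1) (hi + 1) : Set (Site P k)), ∀ st ∈ walk r (w x),
      st.bond.src ∈ (castSite '' Set.Icc (lo - 1) (hi + 1) : Set (Site P k)) ∧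
        st.bond.tgt ∈ (castSite '' Set.Icc (lo - 1) (hi + 1) : Set (Site P k)))
    (hcount : ∀ (s : Site P k) (μ : Fin P.d), s ∈ X → s.shift μ ∈ X →
      ¬ (s ∈ (castSite '' Set.Icc (lo - 1) (hi + 1) : Set (Site P k)) ∧ s.shift μ ∈ (castSite '' Set.Icc (lo - 1) (hi + 1) : Set (Site P k))) →
      ∀ u : List (Letter P.d), (∀ l, u.count l ≤ (w s ++ (μ, true) :: wordRev (w (s.shift μ))).count l) →
      ∀ (a b : Fin P.d) (hab : a < b), (⟨walkEnd r u, a, b, hab⟩ : Plaq P k) ∈ plaqsInside (pts k Z))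
    (𝒞 : Set (PBond P k)) (h𝒞 : ∀ b ∈ 𝒞, b.src ∈ X ∧ b.tgt ∈ X) {ρ : ℝ}
    (hρ : (((2 * ℓ + 1 : ℕ) : ℝ) ^ 2 / 4) * ((12 * P.d * (n + 2) ^ 2 + 1) * ε) + (ℓ + 1) * (3 * P.d * (n + 2) ^ 2 * ε) ≤ ρ) :
    ∃ u : GaugeTransf P k G, (∀ s ∈ pts k Λ, u s = 1) ∧ u (castSite (lo - 1)) = 1 ∧
      ∀ b ∈ 𝒞, dist1 (GaugeField.gaugeAct u (extend (pts k Λ) (shellGauge V lo hi) V) b) ≤ ρ := by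
  obtain ⟨u, huΛ, hu₀, hu⟩ := exists_gauge_normalising_extend_of_words hd hlohi hn hN hbox hZ hε hreg X hbigX r w hX hℓ hℓN hin hcount
  exact ⟨u, huΛ, hu₀, fun b hb => (hu b (h𝒞 b hb).1 (h𝒞 b hb).2).trans hρ⟩

end Prop1

/-! ## §4 (v1.1) HUB REDUCTION: the located Stokes hypothesis only for the loop at the last common hub of the two root words

LOCATED-COUNTBOX (this seat, cell bus l.37172): the count box of the full loop `w s · (+e_μ) · (w (s+e_μ))ᵒᵖ` is centred at the ROOT with
half-width `|s̃ − r̃|`, so §3's letter `hcount` as filed reaches only regions inside a root-centred box.  The repair is conjugation invariance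
of `dist1` ([Balaban1985Averaging] (19)–(20)): a common prefix `p` of the two root words conjugates the loop by `𝒰_W(walk r p)`, so only the
SHORT loop `v · (+e_μ) · v′ᵒᵖ` at the hub `h = walkEnd r p` is read by the located Stokes bound.  With a tree-like word system (shared prefixes
through hubs whose local boxes fit in the region) the normaliser reaches unions of cubes joined through faces. -/

section Hub

variable {P : Params} {j : ℕ} {G : Type*} [GaugeGroup G]

/-- **CONJUGATION BY THE COMMON PREFIX**: if the two root words are `p ++ v` and `p ++ v′`, then
`𝒰(walk r (p++v))·W(b)·𝒰(walk r (p++v′))⁻¹ = g·[𝒰(walk h v)·W(b)·𝒰(walk h v′)⁻¹]·g⁻¹` with `g = 𝒰_W(walk r p)`, `h = walkEnd r p` (multiplicativity of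
parallel transport). [cite: Balaban1985Averaging, (7)-(9) pp.18-19] -/
theorem holAt_bond_conj_of_commonPrefix (W : GaugeField P j G) (r : Site P j) (p v v' : List (Letter P.d)) (b : PBond P j) :
    holAt W (walk r (p ++ v)) * W b * (holAt W (walk r (p ++ v')))⁻¹ =
      holAt W (walk r p) * (holAt W (walk (walkEnd r p) v) * W b * (holAt W (walk (walkEnd r p) v'))⁻¹) * (holAt W (walk r p))⁻¹ := by
  rw [walk_append, walk_append, holAt_append, holAt_append]
  group

/-- ★ **HUB REDUCTION OF THE BOND BOUND**: with root words `w s = p ++ v`, `w (s+e_μ) = p ++ v′` (`|v|, |v′| ≤ ℓ′`, `2ℓ′ + 1 < #sites per direction`), the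
holonomy-gauged bond variable is within `((2ℓ′+1)²∕4)·δ` of `1` as soon as the plaquettes based in the count box of the SHORT loop `v · (+e_μ) · v′ᵒᵖ` AT THE HUB
`h = walkEnd r p` are within `δ` of `1` (`dist1` is conjugation invariant, (19)–(20)). [cite: Balaban1985Variational, (16)-(18) p.280; Balaban1985Averaging, (19)-(20) p.21] -/
theorem dist1_holAt_bond_le_of_words_hub (W : GaugeField P j G) (r s : Site P j) (μ : Fin P.d) (w : Site P j → List (Letter P.d))
    (p v v' : List (Letter P.d)) (hps : w s = p ++ v) (hpt : w (s.shift μ) = p ++ v')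
    (hs : walkEnd r (w s) = s) (ht : walkEnd r (w (s.shift μ)) = s.shift μ) {ℓ' : ℕ} (hℓs : v.length ≤ ℓ')
    (hℓt : v'.length ≤ ℓ') (hℓN : 2 * ℓ' + 1 < P.sitesPerDir j) {δ : ℝ} (hδ : 0 ≤ δ)
    (hloc : ∀ u : List (Letter P.d), (∀ l, u.count l ≤ (v ++ (μ, true) :: wordRev v').count l) →
      ∀ (a b : Fin P.d) (hab : a < b), dist1 (GaugeField.plaqHol W ⟨walkEnd (walkEnd r p) u, a, b, hab⟩) < δ) :
    dist1 (holAt W (walk r (w s)) * W ⟨s, μ⟩ * (holAt W (walk r (w (s.shift μ))))⁻¹) ≤ (((2 * ℓ' + 1 : ℕ) : ℝ) ^ 2 / 4) * δ := by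
  rw [hps, hpt, holAt_bond_conj_of_commonPrefix, GaugeGroup.dist1_conj]
  rw [hps, walkEnd_append] at hs
  rw [hpt, walkEnd_append] at ht
  have hlen : v.length + 1 + v'.length < P.sitesPerDir j := by omega
  refine (dist1_holAt_bond_le_of_sameRoot_of_length_lt W (walkEnd r p) s μ v v' hs ht hlen hδ hloc).trans ?_
  have hm : ((v.length + 1 + v'.length : ℕ) : ℝ) ≤ ((2 * ℓ' + 1 : ℕ) : ℝ) := by exact_mod_cast (by omega)
  have h0 : (0 : ℝ) ≤ ((v.length + 1 + v'.length : ℕ) : ℝ) := Nat.cast_nonneg _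
  exact mul_le_mul_of_nonneg_right (div_le_div_of_nonneg_right (pow_le_pow_left₀ h0 hm 2) (by norm_num)) hδ

/-- **THE GLUING LEMMA WITH THE BOND BOUND DISPLAYED**: `u = 1` on `B`, `u = a` off `B`; if `a` is `η`-near `1` on `B`, `W` is `ε₁`-near `1` on the bonds inside `B`, and
`dist1 (a(s)·W(s,s+e_μ)·a(s+e_μ)⁻¹) ≤ C` on the bonds with both ends in `X` not both in `B`, then `dist1 (W^u b) ≤ C + η + ε₁` on every bond with both ends in `X`
(the four cases of §2 with the one-bond bound as a letter). [cite: Balaban1989LargeFieldI, p.194 (sentence after (1.77)); Balaban1985Averaging, (8)-(9) p.19] -/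
theorem exists_gauge_one_on_nearFlat_of_bondBound (W : GaugeField P j G) (B X : Set (Site P j)) (a : GaugeTransf P j G)
    {C η ε₁ : ℝ} (hC : 0 ≤ C) (hη : 0 ≤ η) (hε₁ : 0 ≤ ε₁)
    (haB : ∀ x ∈ B, dist1 (a x) ≤ η) (h1 : ∀ b : PBond P j, b.src ∈ B → b.tgt ∈ B → dist1 (W b) ≤ ε₁)
    (hab : ∀ (s : Site P j) (μ : Fin P.d), s ∈ X → s.shift μ ∈ X → ¬ (s ∈ B ∧ s.shift μ ∈ B) →
      dist1 (a s * W ⟨s, μ⟩ * (a (s.shift μ))⁻¹) ≤ C) :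
    ∃ u : GaugeTransf P j G, (∀ s ∈ B, u s = 1) ∧ (∀ s, s ∉ B → u s = a s) ∧
      ∀ b : PBond P j, b.src ∈ X → b.tgt ∈ X → dist1 (GaugeField.gaugeAct u W b) ≤ C + η + ε₁ := by
  classical
  refine ⟨fun s => if s ∈ B then 1 else a s, fun s hs => if_pos hs, fun s hs => if_neg hs, ?_⟩
  rintro ⟨s, μ⟩ hs ht
  simp only at hs ht
  change s.shift μ ∈ X at ht
  show dist1 ((if s ∈ B then 1 else a s) * W ⟨s, μ⟩ * (if s.shift μ ∈ B then 1 else a (s.shift μ))⁻¹) ≤ C + η + ε₁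
  by_cases hsB : s ∈ B <;> by_cases htB : s.shift μ ∈ B
  · rw [if_pos hsB, if_pos htB, one_mul, inv_one, mul_one]
    have h := h1 ⟨s, μ⟩ hsB htB
    linarith
  · rw [if_pos hsB, if_neg htB]
    have e1 : (1 : G) * W ⟨s, μ⟩ * (a (s.shift μ))⁻¹ = (a s)⁻¹ * (a s * W ⟨s, μ⟩ * (a (s.shift μ))⁻¹) := by group
    rw [e1]
    calc dist1 ((a s)⁻¹ * (a s * W ⟨s, μ⟩ * (a (s.shift μ))⁻¹))
        ≤ dist1 (a s)⁻¹ + dist1 (a s * W ⟨s, μ⟩ * (a (s.shift μ))⁻¹) := GaugeGroup.dist1_mul_le _ _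
      _ ≤ η + C := by rw [GaugeGroup.dist1_inv]; exact add_le_add (haB s hsB) (hab s μ hs ht (fun h => htB h.2))
      _ ≤ C + η + ε₁ := by linarith
  · rw [if_neg hsB, if_pos htB, inv_one]
    have e1 : a s * W ⟨s, μ⟩ * 1 = (a s * W ⟨s, μ⟩ * (a (s.shift μ))⁻¹) * a (s.shift μ) := by group
    rw [e1]
    calc dist1 ((a s * W ⟨s, μ⟩ * (a (s.shift μ))⁻¹) * a (s.shift μ))
        ≤ dist1 (a s * W ⟨s, μ⟩ * (a (s.shift μ))⁻¹) + dist1 (a (s.shift μ)) := GaugeGroup.dist1_mul_le _ _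
      _ ≤ C + η := add_le_add (hab s μ hs ht (fun h => hsB h.1)) (haB _ htB)
      _ ≤ C + η + ε₁ := by linarith
  · rw [if_neg hsB, if_neg htB]
    have h := hab s μ hs ht (fun h => hsB h.1)
    linarith

/-- ★★ **THE WORD-SYSTEM NORMALISER, HUB EDITION**: as `exists_gauge_one_on_nearFlat_of_words`, but for every bond `⟨s, s+e_μ⟩` with both ends in `X`, not both in
`B`, the located Stokes hypothesis is asked only for the SHORT loop at a hub: `∃ p v v′`, `w s = p ++ v`, `w (s+e_μ) = p ++ v′`, `|v|, |v′| ≤ ℓ′`, and every plaquette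
based in the count box of `v · (+e_μ) · v′ᵒᵖ` at `walkEnd r p` is within `δ` of `1` (`p = []` recovers §2).  Conclusion: `u = 1` on `B`, `u = 𝒰_W(walk r (w ·))` off `B`,
`dist1 (W^u b) ≤ ((2ℓ′+1)²∕4)·δ + (ℓ+1)·ε₁` on the bonds with both ends in `X`. [cite: Balaban1989LargeFieldI, p.194 (sentence after (1.77)); Balaban1985Averaging, (8)-(9) p.19 and (19)-(20) p.21] -/
theorem exists_gauge_one_on_nearFlat_of_words_hub (W : GaugeField P j G) (B X : Set (Site P j)) (hBX : B ⊆ X)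
    (r : Site P j) (w : Site P j → List (Letter P.d)) (hX : ∀ x ∈ X, walkEnd r (w x) = x)
    {ℓ : ℕ} (hℓ : ∀ x ∈ X, (w x).length ≤ ℓ) {ℓ' : ℕ} (hℓ'N : 2 * ℓ' + 1 < P.sitesPerDir j)
    (hin : ∀ x ∈ B, ∀ st ∈ walk r (w x), st.bond.src ∈ B ∧ st.bond.tgt ∈ B)
    {ε₁ δ : ℝ} (hε₁ : 0 ≤ ε₁) (hδ : 0 ≤ δ)
    (h1 : ∀ b : PBond P j, b.src ∈ B → b.tgt ∈ B → dist1 (W b) ≤ ε₁)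
    (hloc : ∀ (s : Site P j) (μ : Fin P.d), s ∈ X → s.shift μ ∈ X → ¬ (s ∈ B ∧ s.shift μ ∈ B) →
      ∃ p v v' : List (Letter P.d), w s = p ++ v ∧ w (s.shift μ) = p ++ v' ∧ v.length ≤ ℓ' ∧ v'.length ≤ ℓ' ∧
        ∀ u : List (Letter P.d), (∀ l, u.count l ≤ (v ++ (μ, true) :: wordRev v').count l) →
          ∀ (a b : Fin P.d) (hab : a < b), dist1 (GaugeField.plaqHol W ⟨walkEnd (walkEnd r p) u, a, b, hab⟩) < δ) :
    ∃ u : GaugeTransf P j G, (∀ s ∈ B, u s = 1) ∧ (∀ s, s ∉ B → u s = holAt W (walk r (w s))) ∧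
      ∀ b : PBond P j, b.src ∈ X → b.tgt ∈ X →
        dist1 (GaugeField.gaugeAct u W b) ≤ (((2 * ℓ' + 1 : ℕ) : ℝ) ^ 2 / 4) * δ + (ℓ + 1) * ε₁ := by
  have hC0 : (0 : ℝ) ≤ (((2 * ℓ' + 1 : ℕ) : ℝ) ^ 2 / 4) * δ := by positivity
  have hη : (0 : ℝ) ≤ ℓ * ε₁ := by positivity
  have haB : ∀ x ∈ B, dist1 (holAt W (walk r (w x))) ≤ ℓ * ε₁ := fun x hx => by
    have h := dist1_holAt_le_length_mul W hε₁ (walk r (w x)) fun st hst => h1 st.bond (hin x hx st hst).1 (hin x hx st hst).2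
    rw [length_walk'] at h
    exact h.trans (mul_le_mul_of_nonneg_right (by exact_mod_cast hℓ x (hBX hx)) hε₁)
  have hab : ∀ (s : Site P j) (μ : Fin P.d), s ∈ X → s.shift μ ∈ X → ¬ (s ∈ B ∧ s.shift μ ∈ B) →
      dist1 (holAt W (walk r (w s)) * W ⟨s, μ⟩ * (holAt W (walk r (w (s.shift μ))))⁻¹) ≤ (((2 * ℓ' + 1 : ℕ) : ℝ) ^ 2 / 4) * δ := by
    intro s μ hs ht hnb
    obtain ⟨p, v, v', hps, hpt, hv, hv', hloc'⟩ := hloc s μ hs ht hnb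
    exact dist1_holAt_bond_le_of_words_hub W r s μ w p v v' hps hpt (hX s hs) (hX _ ht) hv hv' hℓ'N hδ hloc'
  obtain ⟨u, hu1, hua, hu⟩ := exists_gauge_one_on_nearFlat_of_bondBound W B X (fun x => holAt W (walk r (w x))) hC0 hη hε₁ haB h1 hab
  refine ⟨u, hu1, hua, fun b hs ht => (hu b hs ht).trans ?_⟩
  nlinarith

end Hub

/-! ## §5 (v1.1) The hub edition at the objects of Proposition 1 -/

section Prop1Hub

variable {P : Params} {k : ℕ} {G : Type*} [GaugeGroup G] {lo hi : Fin P.d → ℤ}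

/-- ★★★ **THE WORD-SYSTEM NORMALISER OF THE EXTENDED DATUM, HUB EDITION**: as `exists_gauge_normalising_extend_of_words`, with the ONE geometric letter now
asked only at the hubs — `hcount`: for every bond `⟨s, s+e_μ⟩` with both ends in `X`, not both in the big box, `∃ p v v′` with `w s = p ++ v`, `w (s+e_μ) = p ++ v′`,
`|v|, |v′| ≤ ℓ′`, and every plaquette based in the count box of the short loop `v · (+e_μ) · v′ᵒᵖ` at `walkEnd r p` lies in `Z^{(k)}`.  Conclusion: `u = 1` on `Λ^{(k)}`,
`u(c₀) = 1`, `dist1 ((Ṽ_k)^u b) ≤ ((2ℓ′+1)²∕4)·(12d(n+2)² + 1)ε + (ℓ+1)·3d(n+2)²ε` on every bond with both ends in `X`. [cite: Balaban1989LargeFieldI, p.193, p.194 (sentence after (1.77))] -/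
theorem exists_gauge_normalising_extend_of_words_hub (hd : 3 ≤ P.d) (hlohi : lo ≤ hi) {n : ℕ}
    (hn : ∀ κ, hi κ ≤ lo κ + n) (hN : ∀ κ, hi κ - lo κ + 3 < (P.sitesPerDir k : ℤ)) {Z Λ : Set (Site P 0)}
    (hbox : pts k Λ = (castSite '' Set.Icc lo hi : Set (Site P k)))
    (hZ : (boxPlaqs (lo - 1) (hi + 1) : Set (Plaq P k)) ⊆ plaqsInside (pts k Z))
    {ε : ℝ} (hε : 0 < ε) {V : GaugeField P k G} (hreg : PlaqSmallOn (plaqsInside (pts k (Z ∩ Λᶜ))) ε V)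
    (X : Set (Site P k)) (hbigX : (castSite '' Set.Icc (lo - 1) (hi + 1) : Set (Site P k)) ⊆ X)
    (r : Site P k) (w : Site P k → List (Letter P.d)) (hX : ∀ x ∈ X, walkEnd r (w x) = x)
    {ℓ : ℕ} (hℓ : ∀ x ∈ X, (w x).length ≤ ℓ) {ℓ' : ℕ} (hℓ'N : 2 * ℓ' + 1 < P.sitesPerDir k)
    (hin : ∀ x ∈ (castSite '' Set.Icc (lo - 1) (hi + 1) : Set (Site P k)), ∀ st ∈ walk r (w x),
      st.bond.src ∈ (castSite '' Set.Icc (lo - 1) (hi + 1) : Set (Site P k)) ∧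
        st.bond.tgt ∈ (castSite '' Set.Icc (lo - 1) (hi + 1) : Set (Site P k)))
    (hcount : ∀ (s : Site P k) (μ : Fin P.d), s ∈ X → s.shift μ ∈ X →
      ¬ (s ∈ (castSite '' Set.Icc (lo - 1) (hi + 1) : Set (Site P k)) ∧ s.shift μ ∈ (castSite '' Set.Icc (lo - 1) (hi + 1) : Set (Site P k))) →
      ∃ p v v' : List (Letter P.d), w s = p ++ v ∧ w (s.shift μ) = p ++ v' ∧ v.length ≤ ℓ' ∧ v'.length ≤ ℓ' ∧
        ∀ u : List (Letter P.d), (∀ l, u.count l ≤ (v ++ (μ, true) :: wordRev v').count l) →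
          ∀ (a b : Fin P.d) (hab : a < b), (⟨walkEnd (walkEnd r p) u, a, b, hab⟩ : Plaq P k) ∈ plaqsInside (pts k Z)) :
    ∃ u : GaugeTransf P k G, (∀ s ∈ pts k Λ, u s = 1) ∧ u (castSite (lo - 1)) = 1 ∧
      ∀ b : PBond P k, b.src ∈ X → b.tgt ∈ X →
        dist1 (GaugeField.gaugeAct u (extend (pts k Λ) (shellGauge V lo hi) V) b)
          ≤ (((2 * ℓ' + 1 : ℕ) : ℝ) ^ 2 / 4) * ((12 * P.d * (n + 2) ^ 2 + 1) * ε) + (ℓ + 1) * (3 * P.d * (n + 2) ^ 2 * ε) := by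
  set big : Set (Site P k) := castSite '' Set.Icc (lo - 1) (hi + 1) with hbig
  set g : GaugeTransf P k G := shellGauge V lo hi with hg
  set W : GaugeField P k G := extend (pts k Λ) g V with hWdef
  set W' : GaugeField P k G := GaugeField.gaugeAct (cutoff (pts k Λ) g) W with hW'def
  obtain ⟨hplaq, -⟩ := dist1_plaqHol_extend_shellGauge_le (G := G) hd hlohi hn hN hbox hZ hε hreg
  have hW : PlaqSmallOn (plaqsInside (pts k Z)) ((12 * P.d * (n + 2) ^ 2 + 1) * ε) W := fun p hp =>
    calc dist1 (GaugeField.plaqHol W p) ≤ 12 * P.d * (n + 2) ^ 2 * ε := hplaq p hp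
      _ < (12 * P.d * (n + 2) ^ 2 + 1) * ε := by nlinarith
  have hW' : PlaqSmallOn (plaqsInside (pts k Z)) ((12 * P.d * (n + 2) ^ 2 + 1) * ε) W' :=
    (plaqSmallOn_gaugeAct_iff _ _ _ W).2 hW
  have h1 : ∀ b : PBond P k, b.src ∈ big → b.tgt ∈ big → dist1 (W' b) ≤ 3 * P.d * (n + 2) ^ 2 * ε := by
    rintro b ⟨x, ⟨hx, hx'⟩, hsrc⟩ ⟨y, ⟨hy, hy'⟩, htgt⟩
    refine dist1_primed_shellGauge_le_bigBox hd hlohi hn hN hbox hZ hε.le hreg b ⟨x, hx, ?_, hsrc.symm⟩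
    have htgt' : (castSite y : Site P k) = castSite (x + e b.dir) := by
      rw [htgt, castSite_add_e, hsrc]; rfl
    have e1 : ∀ κ, lo κ - 1 ≤ y κ := fun κ => by have h := hy κ; rwa [Pi.sub_apply, Pi.one_apply] at h
    have e2 : ∀ κ, y κ ≤ hi κ + 2 := fun κ => by
      have h : y κ ≤ (hi + 1) κ := hy' κ
      rw [Pi.add_apply, Pi.one_apply] at h; linarith
    have e3 : ∀ κ, lo κ - 1 ≤ (x + e b.dir) κ := fun κ => by
      have h : (lo - 1) κ ≤ x κ := hx κ
      rw [Pi.sub_apply, Pi.one_apply] at h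
      have h0 : (0 : ℤ) ≤ e b.dir κ := by rw [e_apply]; split_ifs <;> simp
      rw [Pi.add_apply]; linarith
    have e4 : ∀ κ, (x + e b.dir) κ ≤ hi κ + 2 := fun κ => by
      have h : x κ ≤ (hi + 1) κ := hx' κ
      rw [Pi.add_apply, Pi.one_apply] at h
      have h0 : e b.dir κ ≤ (1 : ℤ) := by rw [e_apply]; split_ifs <;> simp
      rw [Pi.add_apply]; linarith
    have heq : y = x + e b.dir := B15Extension193.castSite_inj_big hN e1 e2 e3 e4 htgt'
    rw [← heq]; exact hy'
  have hε' : (0 : ℝ) ≤ (12 * P.d * (n + 2) ^ 2 + 1) * ε := by positivity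
  have hε₁ : (0 : ℝ) ≤ 3 * P.d * (n + 2) ^ 2 * ε := by positivity
  have hloc : ∀ (s : Site P k) (μ : Fin P.d), s ∈ X → s.shift μ ∈ X → ¬ (s ∈ big ∧ s.shift μ ∈ big) →
      ∃ p v v' : List (Letter P.d), w s = p ++ v ∧ w (s.shift μ) = p ++ v' ∧ v.length ≤ ℓ' ∧ v'.length ≤ ℓ' ∧
        ∀ u : List (Letter P.d), (∀ l, u.count l ≤ (v ++ (μ, true) :: wordRev v').count l) →
          ∀ (a b : Fin P.d) (hab : a < b),
            dist1 (GaugeField.plaqHol W' ⟨walkEnd (walkEnd r p) u, a, b, hab⟩) < (12 * P.d * (n + 2) ^ 2 + 1) * ε := by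
    intro s μ hs ht hnb
    obtain ⟨p, v, v', hps, hpt, hv, hv', hmem⟩ := hcount s μ hs ht hnb
    exact ⟨p, v, v', hps, hpt, hv, hv', fun u hu a b hab => hW' _ (hmem u hu a b hab)⟩
  obtain ⟨u', hu'1, -, hu'⟩ :=
    exists_gauge_one_on_nearFlat_of_words_hub W' big X hbigX r w hX hℓ hℓ'N hin hε₁ hε' h1 hloc
  have hc₀big : (castSite (lo - 1) : Site P k) ∈ big :=
    ⟨lo - 1, ⟨le_rfl, fun κ => by have := hlohi κ; rw [Pi.sub_apply, Pi.add_apply, Pi.one_apply]; linarith⟩, rfl⟩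
  have hc₀Λ : (castSite (lo - 1) : Site P k) ∉ pts k Λ := by
    rw [hbox]
    rintro ⟨x, ⟨hx, hx'⟩, hxe⟩
    have heq : x = lo - 1 := B15Extension193.castSite_inj_big hN
      (fun κ => by have := hx κ; linarith) (fun κ => by have := hx' κ; linarith)
      (fun κ => by rw [Pi.sub_apply, Pi.one_apply]) (fun κ => by have := hlohi κ; rw [Pi.sub_apply, Pi.one_apply]; linarith) hxe
    have hd0 : 0 < P.d := by omega
    have := hx ⟨0, hd0⟩
    rw [heq, Pi.sub_apply, Pi.one_apply] at this
    linarith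
  refine ⟨fun s => u' s * cutoff (pts k Λ) g s, fun s hs => ?_, ?_, fun b hs ht => ?_⟩
  · have hs' : s ∈ big := by
      have hs2 := hs
      rw [hbox] at hs2; obtain ⟨x, ⟨hx, hx'⟩, rfl⟩ := hs2; exact mem_bigBox_of_mem_box hx hx'
    show u' s * cutoff (pts k Λ) g s = 1
    rw [hu'1 s hs', cutoff_of_mem g hs, one_mul]
  · show u' (castSite (lo - 1)) * cutoff (pts k Λ) g (castSite (lo - 1)) = 1
    rw [hu'1 _ hc₀big, cutoff_of_not_mem g hc₀Λ, one_mul, hg, shellGauge_corner_eq_one hlohi hN V]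
  · rw [gaugeAct_mul_eq]
    exact hu' b hs ht

/-- ★★★ **HUB EDITION IN THE SHAPE OF THE LETTER `hgauge`**: any bond set `𝒞` with ends in `X`, any `ρ` above the explicit constant. [cite: Balaban1989LargeFieldI, p.193, p.194 (sentence after (1.77))] -/
theorem exists_gauge_normalising_extend_of_words_hub_le (hd : 3 ≤ P.d) (hlohi : lo ≤ hi) {n : ℕ}
    (hn : ∀ κ, hi κ ≤ lo κ + n) (hN : ∀ κ, hi κ - lo κ + 3 < (P.sitesPerDir k : ℤ)) {Z Λ : Set (Site P 0)}
    (hbox : pts k Λ = (castSite '' Set.Icc lo hi : Set (Site P k)))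
    (hZ : (boxPlaqs (lo - 1) (hi + 1) : Set (Plaq P k)) ⊆ plaqsInside (pts k Z))
    {ε : ℝ} (hε : 0 < ε) {V : GaugeField P k G} (hreg : PlaqSmallOn (plaqsInside (pts k (Z ∩ Λᶜ))) ε V)
    (X : Set (Site P k)) (hbigX : (castSite '' Set.Icc (lo - 1) (hi + 1) : Set (Site P k)) ⊆ X)
    (r : Site P k) (w : Site P k → List (Letter P.d)) (hX : ∀ x ∈ X, walkEnd r (w x) = x)
    {ℓ : ℕ} (hℓ : ∀ x ∈ X, (w x).length ≤ ℓ) {ℓ' : ℕ} (hℓ'N : 2 * ℓ' + 1 < P.sitesPerDir k)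
    (hin : ∀ x ∈ (castSite '' Set.Icc (lo - 1) (hi + 1) : Set (Site P k)), ∀ st ∈ walk r (w x),
      st.bond.src ∈ (castSite '' Set.Icc (lo - 1) (hi + 1) : Set (Site P k)) ∧
        st.bond.tgt ∈ (castSite '' Set.Icc (lo - 1) (hi + 1) : Set (Site P k)))
    (hcount : ∀ (s : Site P k) (μ : Fin P.d), s ∈ X → s.shift μ ∈ X →
      ¬ (s ∈ (castSite '' Set.Icc (lo - 1) (hi + 1) : Set (Site P k)) ∧ s.shift μ ∈ (castSite '' Set.Icc (lo - 1) (hi + 1) : Set (Site P k))) →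
      ∃ p v v' : List (Letter P.d), w s = p ++ v ∧ w (s.shift μ) = p ++ v' ∧ v.length ≤ ℓ' ∧ v'.length ≤ ℓ' ∧
        ∀ u : List (Letter P.d), (∀ l, u.count l ≤ (v ++ (μ, true) :: wordRev v').count l) →
          ∀ (a b : Fin P.d) (hab : a < b), (⟨walkEnd (walkEnd r p) u, a, b, hab⟩ : Plaq P k) ∈ plaqsInside (pts k Z))
    (𝒞 : Set (PBond P k)) (h𝒞 : ∀ b ∈ 𝒞, b.src ∈ X ∧ b.tgt ∈ X) {ρ : ℝ}
    (hρ : (((2 * ℓ' + 1 : ℕ) : ℝ) ^ 2 / 4) * ((12 * P.d * (n + 2) ^ 2 + 1) * ε) + (ℓ + 1) * (3 * P.d * (n + 2) ^ 2 * ε) ≤ ρ) :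
    ∃ u : GaugeTransf P k G, (∀ s ∈ pts k Λ, u s = 1) ∧ u (castSite (lo - 1)) = 1 ∧
      ∀ b ∈ 𝒞, dist1 (GaugeField.gaugeAct u (extend (pts k Λ) (shellGauge V lo hi) V) b) ≤ ρ := by
  obtain ⟨u, huΛ, hu₀, hu⟩ := exists_gauge_normalising_extend_of_words_hub hd hlohi hn hN hbox hZ hε hreg X hbigX r w hX hℓ hℓ'N hin hcount
  exact ⟨u, huΛ, hu₀, fun b hb => (hu b (h𝒞 b hb).1 (h𝒞 b hb).2).trans hρ⟩

end Prop1Hub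

/-! ## §6 (v1.2) REROUTING CHAINS: the one-bond bound through a chain of intermediate root words

LOCATED-INTERFACE (this seat, cell bus): with ONE hub per bond, a bond crossing the shared face of two face-glued boxes routed through
different box centres has a reduced loop whose count box leaves the union (gluing axis `μ`: `[c_μ − M, c_μ + M]` for `M`-cubes).  The remedy
is again (19)–(20): REROUTE the root word of one endpoint through a CHAIN of intermediate root words `u₀ = w s, u₁, …, u_m` (all ending at `s`);
`a(s)·W(b)·a(t)⁻¹ = Π_i [𝒰(u_i)·𝒰(u_{i+1})⁻¹] · [𝒰(u_m)·W(b)·𝒰(w t)⁻¹]`, every factor a loop reduced at the common prefix of two CONSECUTIVE words;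
through the face centre three local factors suffice for the cube template.  This section supplies the rerouting loop and the chain bound; the
one-bond letter `hab` of `exists_gauge_one_on_nearFlat_of_bondBound` (§4) is then produced factor by factor. -/

section Reroute

variable {P : Params} {j : ℕ} {G : Type*} [GaugeGroup G]

/-- `-|w| ≤ netDisp w ν ≤ |w|` (the tree's private twin in `T4ForestGaugeSameRootBound`). [cite: Balaban1985Averaging, (5)-(9) pp.18-19] -/
theorem netDisp_abs_le_length {n : ℕ} (ν : Fin n) : ∀ w : List (Letter n), netDisp w ν ≤ (w.length : ℤ) ∧ -(w.length : ℤ) ≤ netDisp w ν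
  | [] => by simp [netDisp]
  | l :: w => by
      have ih := netDisp_abs_le_length ν w
      rw [netDisp_cons, List.length_cons]
      push_cast
      split_ifs <;> constructor <;> linarith [ih.1, ih.2]

/-- **NO WRAPPING FOR TWO SHORT WORDS TO THE SAME SITE**: if `walk h v` and `walk h v′` end at the same site and `|v| + |v′| <` the number of sites per direction,
their integer displacements agree. [cite: Balaban1985Averaging, (5)-(9) pp.18-19] -/
theorem netDisp_eq_of_walkEnd_eq (h : Site P j) (v v' : List (Letter P.d)) (hend : walkEnd h v = walkEnd h v')
    (hlen : v.length + v'.length < P.sitesPerDir j) (ν : Fin P.d) : netDisp v ν = netDisp v' ν := by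
  have key : ((netDisp v ν - netDisp v' ν : ℤ) : ZMod (P.sitesPerDir j)) = 0 := by
    have h1 := walkEnd_apply h v ν
    have h2 := walkEnd_apply h v' ν
    rw [hend, h2] at h1
    push_cast
    linear_combination -h1
  rw [ZMod.intCast_zmod_eq_zero_iff_dvd] at key
  have hm := netDisp_abs_le_length ν v
  have hp := netDisp_abs_le_length ν v'
  have hN : ((v.length : ℤ) + v'.length) < (P.sitesPerDir j : ℤ) := by exact_mod_cast hlen
  have habs : |netDisp v ν - netDisp v' ν| < (P.sitesPerDir j : ℤ) := by
    rw [abs_lt]; constructor <;> linarith [hm.1, hm.2, hp.1, hp.2]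
  have h0 := Int.eq_zero_of_abs_lt_dvd key habs
  linarith

/-- **THE REROUTING LOOP**: two root words `p ++ v`, `p ++ v′` to the same site differ by the holonomy of the closed word `v · v′ᵒᵖ` at the hub `h = walkEnd r p`,
conjugated by `𝒰_W(walk r p)`. [cite: Balaban1985Averaging, (7)-(9) pp.18-19] -/
theorem holAt_reroute_conj (W : GaugeField P j G) (r : Site P j) (p v v' : List (Letter P.d))
    (hend : walkEnd (walkEnd r p) v = walkEnd (walkEnd r p) v') :
    holAt W (walk r (p ++ v)) * (holAt W (walk r (p ++ v')))⁻¹ =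
      holAt W (walk r p) * holAt W (walk (walkEnd r p) (v ++ wordRev v')) * (holAt W (walk r p))⁻¹ := by
  rw [walk_append, walk_append, holAt_append, holAt_append, walk_append, holAt_append, hend, holAt_walk_wordRev]
  group

/-- ★ **THE REROUTING BOUND**: `dist1 (𝒰(walk r (p++v))·𝒰(walk r (p++v′))⁻¹) ≤ ((|v|+|v′|)²∕4)·δ` when both words end at the same site, `|v| + |v′| <` the number of
sites per direction, and every plaquette based in the count box of the closed word `v · v′ᵒᵖ` AT THE HUB `walkEnd r p` is within `δ` of `1` (conjugation invariance +
the located Stokes bound of `LatticeWordStokesLocal`). [cite: Balaban1985Averaging, (19)-(20) p.21] -/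
theorem dist1_reroute_le_local (W : GaugeField P j G) (r : Site P j) (p v v' : List (Letter P.d))
    (hend : walkEnd (walkEnd r p) v = walkEnd (walkEnd r p) v') (hlen : v.length + v'.length < P.sitesPerDir j) {δ : ℝ} (hδ : 0 ≤ δ)
    (hloc : ∀ u : List (Letter P.d), (∀ l, u.count l ≤ (v ++ wordRev v').count l) →
      ∀ (a b : Fin P.d) (hab : a < b), dist1 (GaugeField.plaqHol W ⟨walkEnd (walkEnd r p) u, a, b, hab⟩) < δ) :
    dist1 (holAt W (walk r (p ++ v)) * (holAt W (walk r (p ++ v')))⁻¹) ≤ ((((v ++ wordRev v').length : ℕ) : ℝ) ^ 2 / 4) * δ := by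
  rw [holAt_reroute_conj W r p v v' hend, GaugeGroup.dist1_conj]
  refine LatticeWordStokesLocal.dist1_holAt_le_local W hδ (walkEnd r p) (v ++ wordRev v') hloc fun ν => ?_
  rw [netDisp_append, netDisp_wordRev, netDisp_eq_of_walkEnd_eq (walkEnd r p) v v' hend hlen ν]
  ring

/-- The length of the rerouting loop word: `|v · v′ᵒᵖ| = |v| + |v′|`. [cite: Balaban1985Averaging, (5)-(9) pp.18-19] -/
theorem length_append_wordRev (v v' : List (Letter P.d)) : (v ++ wordRev v').length = v.length + v'.length := by
  simp [wordRev]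

/-- ★★ **THE CHAIN BOUND**: for a chain of root words `u₀, u₁, …` given as a list `us` of words all meant to end at `s`, and the root word `wt` of `s + e_μ`:
`dist1 (𝒰(u₀)·W(s,μ)·𝒰(wt)⁻¹) ≤ Σ_i dist1 (𝒰(u_i)·𝒰(u_{i+1})⁻¹) + dist1 (𝒰(u_last)·W(s,μ)·𝒰(wt)⁻¹)` — by `|XY − 1| ≤ |X − 1| + |Y − 1|` along
`𝒰(u₀)·W·𝒰(wt)⁻¹ = [𝒰(u₀)𝒰(u₁)⁻¹]·[𝒰(u₁)·W·𝒰(wt)⁻¹]`.  Stated for any function `Φ` of words (here `Φ u = 𝒰_W(walk r u)`) to keep the algebra visible. [cite: Balaban1985Averaging, (19)-(20) p.21] -/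
theorem dist1_chain_le (Φ : List (Letter P.d) → G) (X Y : G) :
    ∀ (u : List (Letter P.d)) (us : List (List (Letter P.d))),
      dist1 (Φ u * X * Y⁻¹) ≤
        (List.zipWith (fun a b => dist1 (Φ a * (Φ b)⁻¹)) (u :: us) us).sum + dist1 (Φ ((u :: us).getLast (List.cons_ne_nil u us)) * X * Y⁻¹)
  | u, [] => by simp
  | u, u' :: us => by
    have ih := dist1_chain_le Φ X Y u' us
    have e1 : Φ u * X * Y⁻¹ = (Φ u * (Φ u')⁻¹) * (Φ u' * X * Y⁻¹) := by group
    rw [e1, List.zipWith_cons_cons, List.sum_cons, List.getLast_cons (List.cons_ne_nil u' us)]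
    calc dist1 ((Φ u * (Φ u')⁻¹) * (Φ u' * X * Y⁻¹)) ≤ dist1 (Φ u * (Φ u')⁻¹) + dist1 (Φ u' * X * Y⁻¹) := GaugeGroup.dist1_mul_le _ _
      _ ≤ _ := by rw [add_assoc]; exact add_le_add le_rfl ih

/-- ★★ **TWO REROUTINGS AND A HUB LOOP** (the shape the face-glued cube template uses): if `w s = p₁ ++ v₁`, `u₁ = p₁ ++ v₁′ = p₂ ++ v₂`, `u₂ = p₂ ++ v₂′ = p₃ ++ v₃` (all three ending at `s`)
and `w (s+e_μ) = p₃ ++ v₃′`, with the located Stokes hypothesis for the two rerouting loops `v₁·v₁′ᵒᵖ` at `walkEnd r p₁`, `v₂·v₂′ᵒᵖ` at `walkEnd r p₂` and for the bond loop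
`v₃·(+e_μ)·v₃′ᵒᵖ` at `walkEnd r p₃` (short words: sums of lengths below the number of sites per direction), then
`dist1 (a(s)·W(s,s+e_μ)·a(s+e_μ)⁻¹) ≤ ((|v₁|+|v₁′|)² + (|v₂|+|v₂′|)² + (|v₃|+1+|v₃′|)²)∕4 · δ`. [cite: Balaban1985Averaging, (19)-(20) p.21; Balaban1985Variational, (16)-(18) p.280] -/
theorem dist1_holAt_bond_le_of_two_reroutes (W : GaugeField P j G) (r s : Site P j) (μ : Fin P.d) (ws wt u₁ u₂ : List (Letter P.d))
    (p₁ v₁ v₁' p₂ v₂ v₂' p₃ v₃ v₃' : List (Letter P.d))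
    (h₁ : ws = p₁ ++ v₁) (h₁' : u₁ = p₁ ++ v₁') (h₂ : u₁ = p₂ ++ v₂) (h₂' : u₂ = p₂ ++ v₂') (h₃ : u₂ = p₃ ++ v₃) (h₃' : wt = p₃ ++ v₃')
    (hs : walkEnd r ws = s) (hs₁ : walkEnd r u₁ = s) (hs₂ : walkEnd r u₂ = s) (ht : walkEnd r wt = s.shift μ)
    (hl₁ : v₁.length + v₁'.length < P.sitesPerDir j) (hl₂ : v₂.length + v₂'.length < P.sitesPerDir j)
    (hl₃ : v₃.length + 1 + v₃'.length < P.sitesPerDir j) {δ : ℝ} (hδ : 0 ≤ δ)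
    (hloc₁ : ∀ u : List (Letter P.d), (∀ l, u.count l ≤ (v₁ ++ wordRev v₁').count l) →
      ∀ (a b : Fin P.d) (hab : a < b), dist1 (GaugeField.plaqHol W ⟨walkEnd (walkEnd r p₁) u, a, b, hab⟩) < δ)
    (hloc₂ : ∀ u : List (Letter P.d), (∀ l, u.count l ≤ (v₂ ++ wordRev v₂').count l) →
      ∀ (a b : Fin P.d) (hab : a < b), dist1 (GaugeField.plaqHol W ⟨walkEnd (walkEnd r p₂) u, a, b, hab⟩) < δ)
    (hloc₃ : ∀ u : List (Letter P.d), (∀ l, u.count l ≤ (v₃ ++ (μ, true) :: wordRev v₃').count l) →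
      ∀ (a b : Fin P.d) (hab : a < b), dist1 (GaugeField.plaqHol W ⟨walkEnd (walkEnd r p₃) u, a, b, hab⟩) < δ) :
    dist1 (holAt W (walk r ws) * W ⟨s, μ⟩ * (holAt W (walk r wt))⁻¹)
      ≤ ((((v₁.length + v₁'.length : ℕ) : ℝ) ^ 2 + ((v₂.length + v₂'.length : ℕ) : ℝ) ^ 2
          + ((v₃.length + 1 + v₃'.length : ℕ) : ℝ) ^ 2) / 4) * δ := by
  -- the two rerouting loops
  have e₁ : walkEnd (walkEnd r p₁) v₁ = walkEnd (walkEnd r p₁) v₁' := by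
    rw [← walkEnd_append, ← walkEnd_append, ← h₁, ← h₁', hs, hs₁]
  have e₂ : walkEnd (walkEnd r p₂) v₂ = walkEnd (walkEnd r p₂) v₂' := by
    rw [← walkEnd_append, ← walkEnd_append, ← h₂, ← h₂', hs₁, hs₂]
  have d₁ := dist1_reroute_le_local W r p₁ v₁ v₁' e₁ hl₁ hδ hloc₁
  have d₂ := dist1_reroute_le_local W r p₂ v₂ v₂' e₂ hl₂ hδ hloc₂
  rw [length_append_wordRev] at d₁ d₂
  rw [← h₁, ← h₁'] at d₁
  rw [← h₂, ← h₂'] at d₂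
  -- the bond loop at the last hub
  have hs₃ : walkEnd (walkEnd r p₃) v₃ = s := by rw [← walkEnd_append, ← h₃, hs₂]
  have ht₃ : walkEnd (walkEnd r p₃) v₃' = s.shift μ := by rw [← walkEnd_append, ← h₃', ht]
  have d₃ := dist1_holAt_bond_le_of_sameRoot_of_length_lt W (walkEnd r p₃) s μ v₃ v₃' hs₃ ht₃ hl₃ hδ hloc₃
  have e₃ : holAt W (walk r u₂) * W ⟨s, μ⟩ * (holAt W (walk r wt))⁻¹ =
      holAt W (walk r p₃) * (holAt W (walk (walkEnd r p₃) v₃) * W ⟨s, μ⟩ * (holAt W (walk (walkEnd r p₃) v₃'))⁻¹) * (holAt W (walk r p₃))⁻¹ := by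
    rw [h₃, h₃']; exact holAt_bond_conj_of_commonPrefix W r p₃ v₃ v₃' ⟨s, μ⟩
  have d₃' : dist1 (holAt W (walk r u₂) * W ⟨s, μ⟩ * (holAt W (walk r wt))⁻¹) ≤ (((v₃.length + 1 + v₃'.length : ℕ) : ℝ) ^ 2 / 4) * δ := by
    rw [e₃, GaugeGroup.dist1_conj]; exact d₃
  -- chain
  have chain : dist1 (holAt W (walk r ws) * W ⟨s, μ⟩ * (holAt W (walk r wt))⁻¹)
      ≤ dist1 (holAt W (walk r ws) * (holAt W (walk r u₁))⁻¹) + dist1 (holAt W (walk r u₁) * (holAt W (walk r u₂))⁻¹)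
          + dist1 (holAt W (walk r u₂) * W ⟨s, μ⟩ * (holAt W (walk r wt))⁻¹) := by
    have h := dist1_chain_le (fun u => holAt W (walk r u)) (W ⟨s, μ⟩) (holAt W (walk r wt)) ws [u₁, u₂]
    simp only [List.zipWith_cons_cons, List.zipWith_nil_right, List.sum_cons, List.sum_nil, add_zero] at h
    exact h
  calc dist1 (holAt W (walk r ws) * W ⟨s, μ⟩ * (holAt W (walk r wt))⁻¹)
      ≤ dist1 (holAt W (walk r ws) * (holAt W (walk r u₁))⁻¹) + dist1 (holAt W (walk r u₁) * (holAt W (walk r u₂))⁻¹)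
          + dist1 (holAt W (walk r u₂) * W ⟨s, μ⟩ * (holAt W (walk r wt))⁻¹) := chain
    _ ≤ (((v₁.length + v₁'.length : ℕ) : ℝ) ^ 2 / 4) * δ + (((v₂.length + v₂'.length : ℕ) : ℝ) ^ 2 / 4) * δ
          + (((v₃.length + 1 + v₃'.length : ℕ) : ℝ) ^ 2 / 4) * δ := add_le_add (add_le_add d₁ d₂) d₃'
    _ = _ := by ring

end Reroute

end Literature.MathematicalPhysics.QuantumFieldTheory.Balaban1983to89.T4WordSystemGaugeBound

end
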